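import Summits.QuantumFields.BalabanUV.T4Continuum.Support.T4TrajectoryDensityFresh

/-!
# `T4Continuum.T4TrajectoryDensityFreshWitness` — the recentring GAIN is strict (decided toy): for a LINEAR observable term the
# CENTRED perturbation slice has size `M·θ₀/2` (the fresh fluctuation scale, window-independent) while the UNCENTRED shape of
# part 1's `hP` cannot be met below `M·(w + θ₀)/2` (the window scale) (cell `pub-balaban`, sub-cell `t4`, spine estimate NE1′
# (node O3b/H2), lineage t4-ne1p-p1 = PROVER seat P1 «RG-trajectory comparison», generation 22; tree target
# `Summits/QuantumFields/BalabanUV/T4Continuum/Support/`; ADDITIVE toy — imports `T4TrajectoryDensityFresh` ONLY)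

HONEST FRAMING.  A two-atom TOY on `ℂ` certifying that generation 22's centred binder (`transportsFromVar_of_centredExponent_lattice`,
`hP` asked of `𝒬 k U z − q k U`) is STRICTLY weaker than part 1's uncentred one on data with a genuine observable term —
nothing of Bałaban's is modelled; [folklore], 0 sorry, 0 citations; rung (B)+1 finite T⁴ only; NOT summit progress.
«continuum YM on T⁴ ⇐ BetaPertH ∧ nine spine estimates (0/9 proved); BetaPertH ⇐ (D1) ∧ (D4) ∧ CAP+tail; G-an2-4 gates
asym, D1 and NE2/3/4».

CONTENTS.  Configurations `V = ℂ`, chart `move U d t = U + t·d`, norm `N d = ‖d‖`, observable term `G U = M·U` (`M ≥ 0`),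
fluctuation measure `δ_0 + δ_{θ₀}` (two atoms, `θ₀ ≥ 0`), reference fluctuation `z₁ = 0`.  `pertSlice_centred_lin`: the
centred exponent `G (U + z) − G (U + 0) = M·z` is background-FREE, so it is a perturbation slice of size `M·θ₀/2` on ANY
window, ANY radius, ANY window norm bound `w`.  `not_pertSlice_uncentred_lin`: the uncentred exponent `G (U + z)` is NOT a
perturbation slice of any size `s₁` with `2·s₁ < M·(w + θ₀)` (`0 < w`, window containing `0`): testing the direction
`d = w` at `t = 0, z = 0` and `t = 1, z = θ₀` forces `M·(w + θ₀) ≤ 2 s₁`.  So on the window scale `w = O(1)` the uncentred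
shape charges the FULL response `M·w` of the term to a window-size motion of the background — the over-charge that made part
2's `source_bound_noContraction` bite — and the centred shape charges only the fresh scale `θ₀`.
-/

namespace Summit.QuantumFields.BalabanUV.T4Continuum.T4TrajectoryDensityDressed

open MeasureTheory Set Metric Filter
open Literature.MathematicalPhysics.QuantumFieldTheory.Balaban1983to89
open T4TrajectoryDensity

noncomputable section

namespace FreshToy

/-- The toy chart on `ℂ`: `move U d t = U + t·d`. [folklore] -/
def mv (U d t : ℂ) : ℂ := U + t * d

/-- The toy window norm: `N d = ‖d‖`. [folklore] -/
def nm (d : ℂ) : ℝ := ‖d‖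

/-- The two-atom fluctuation measure `δ_0 + δ_{θ₀}`. [folklore] -/
def twoAtoms (θ₀ : ℝ) : Measure ℂ := Measure.dirac 0 + Measure.dirac (θ₀ : ℂ)

/-- The linear observable term `G U = M·U`. [folklore] -/
def lin (M : ℝ) (U : ℂ) : ℂ := (M : ℂ) * U

/-- Almost everywhere for the two-atom measure = at both atoms. [folklore] -/
theorem ae_twoAtoms_iff {θ₀ : ℝ} {p : ℂ → Prop} : (∀ᵐ z ∂twoAtoms θ₀, p z) ↔ p 0 ∧ p (θ₀ : ℂ) := by
  unfold twoAtoms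
  rw [ae_add_measure_iff]
  show ((∀ᶠ z in ae (Measure.dirac (0 : ℂ)), p z) ∧ ∀ᶠ z in ae (Measure.dirac (θ₀ : ℂ)), p z) ↔ p 0 ∧ p (θ₀ : ℂ)
  rw [ae_dirac_eq, ae_dirac_eq, eventually_pure, eventually_pure]

end FreshToy

open FreshToy

/-- **THE CENTRED SLICE OF A LINEAR TERM IS BACKGROUND-FREE**: `lin M (U + z) − lin M (U + 0) = M·z`, so for the two-atom
measure it is a perturbation slice of size `M·θ₀/2` (about `q₀ = M·θ₀/2`) on ANY window `𝒦`, with ANY `w`, `ϱ`. [folklore] -/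
theorem pertSlice_centred_lin {M θ₀ : ℝ} (hM : 0 ≤ M) (hθ₀ : 0 ≤ θ₀) (𝒦 : Set ℂ) (w ϱ : ℝ) :
    PertSlice (fun U z => lin M (U + z) - lin M (U + 0)) (twoAtoms θ₀) mv nm 𝒦 w ϱ (M * θ₀ / 2) := by
  intro U₀ _ d _ _
  refine ⟨univ, isOpen_univ, fun _ _ => subset_univ _, fun t _ => ?_, ?_, (M * θ₀ / 2 : ℝ), ?_⟩
  · show AEStronglyMeasurable (fun z => (M : ℂ) * (mv U₀ d t + z) - (M : ℂ) * (mv U₀ d t + 0)) (twoAtoms θ₀)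
    exact ((continuous_const.mul (continuous_const.add continuous_id)).sub continuous_const).aestronglyMeasurable
  · refine Eventually.of_forall fun z => ?_
    show DifferentiableOn ℂ (fun t => (M : ℂ) * (mv U₀ d t + z) - (M : ℂ) * (mv U₀ d t + 0)) univ
    have : (fun t => (M : ℂ) * (mv U₀ d t + z) - (M : ℂ) * (mv U₀ d t + 0)) = fun _ => (M : ℂ) * z :=
      funext fun t => by simp only [mv]; ring
    rw [this]
    exact differentiableOn_const _
  · refine ae_twoAtoms_iff.mpr ⟨fun t _ => ?_, fun t _ => ?_⟩
    · show ‖(lin M (mv U₀ d t + 0) - lin M (mv U₀ d t + 0)) - ((M * θ₀ / 2 : ℝ) : ℂ)‖ ≤ M * θ₀ / 2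
      rw [sub_self, zero_sub, norm_neg, Complex.norm_real, Real.norm_eq_abs, abs_of_nonneg (by positivity)]
    · show ‖(lin M (mv U₀ d t + θ₀) - lin M (mv U₀ d t + 0)) - ((M * θ₀ / 2 : ℝ) : ℂ)‖ ≤ M * θ₀ / 2
      have : lin M (mv U₀ d t + θ₀) - lin M (mv U₀ d t + 0) - ((M * θ₀ / 2 : ℝ) : ℂ) = ((M * θ₀ / 2 : ℝ) : ℂ) := by
        simp only [lin]
        push_cast
        ring
      rw [this, Complex.norm_real, Real.norm_eq_abs, abs_of_nonneg (by positivity)]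

/-- **THE UNCENTRED SHAPE MUST PAY THE WINDOW SCALE**: on a window containing `0`, with window-norm bound `w > 0`, the
uncentred exponent `(U, z) ↦ lin M (U + z)` is NOT a perturbation slice of any size `s₁` with `2 s₁ < M·(w + θ₀)` — the
direction `d = w` tested at `(t, z) = (0, 0)` and `(1, θ₀)` forces `M (w + θ₀) = ‖M(w + θ₀) − q₀ + q₀ − 0‖ ≤ 2 s₁`. [folklore] -/
theorem not_pertSlice_uncentred_lin {M θ₀ w ϱ s₁ : ℝ} (hM : 0 ≤ M) (hθ₀ : 0 ≤ θ₀) (hw : 0 < w) (hϱ : 0 ≤ ϱ)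
    {𝒦 : Set ℂ} (h0 : (0 : ℂ) ∈ 𝒦) (hs : 2 * s₁ < M * (w + θ₀)) :
    ¬ PertSlice (fun U z => lin M (U + z)) (twoAtoms θ₀) mv nm 𝒦 w ϱ s₁ := by
  intro h
  have hNw : nm (w : ℂ) = w := by simp [nm, abs_of_pos hw]
  obtain ⟨Ω, -, hballs, -, -, q₀, hbd⟩ := h 0 h0 (w : ℂ) (by rw [hNw]; exact hw) (by rw [hNw])
  have h0Ω : (0 : ℂ) ∈ Ω :=
    hballs 0 ⟨le_rfl, zero_le_one⟩ (by simpa using div_nonneg hϱ (by rw [hNw]; exact hw.le))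
  have h1Ω : (1 : ℂ) ∈ Ω :=
    hballs 1 ⟨zero_le_one, le_rfl⟩ (by simpa using div_nonneg hϱ (by rw [hNw]; exact hw.le))
  obtain ⟨hz0, hzθ⟩ := ae_twoAtoms_iff.mp hbd
  have a := hz0 0 h0Ω
  have b := hzθ 1 h1Ω
  simp only [lin, mv, zero_add, add_zero, zero_mul, mul_zero, zero_sub, norm_neg, one_mul] at a b
  -- `a : ‖q₀‖ ≤ s₁`, `b : ‖M·(w + θ₀) − q₀‖ ≤ s₁`
  have key : ‖(M : ℂ) * ((w : ℂ) + (θ₀ : ℂ))‖ ≤ 2 * s₁ :=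
    calc ‖(M : ℂ) * ((w : ℂ) + (θ₀ : ℂ))‖ = ‖((M : ℂ) * ((w : ℂ) + (θ₀ : ℂ)) - q₀) + q₀‖ := by rw [sub_add_cancel]
      _ ≤ ‖(M : ℂ) * ((w : ℂ) + (θ₀ : ℂ)) - q₀‖ + ‖q₀‖ := norm_add_le _ _
      _ ≤ s₁ + s₁ := add_le_add b a
      _ = 2 * s₁ := by ring
  have hre : ‖(M : ℂ) * ((w : ℂ) + (θ₀ : ℂ))‖ = M * (w + θ₀) := by
    rw [show (M : ℂ) * ((w : ℂ) + (θ₀ : ℂ)) = ((M * (w + θ₀) : ℝ) : ℂ) by push_cast; ring, Complex.norm_real,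
      Real.norm_eq_abs, abs_of_nonneg (by positivity)]
  linarith [hre ▸ key]

/-- DECIDED CONTRAST (numbers): with `M = 1`, window bound `w = 1`, fresh scale `θ₀ = 1/100`: the centred binder is met at size
`1/200`, the uncentred one is refuted at every size `< 101/200` — a factor `101`. [folklore] -/
example : PertSlice (fun U z => lin 1 (U + z) - lin 1 (U + 0)) (twoAtoms (1 / 100)) mv nm (closedBall 0 1) 1 (1 / 4)
      (1 * (1 / 100) / 2) ∧
    ¬ PertSlice (fun U z => lin 1 (U + z)) (twoAtoms (1 / 100)) mv nm (closedBall 0 1) 1 (1 / 4) (1 / 2) :=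
  ⟨pertSlice_centred_lin zero_le_one (by norm_num) _ _ _,
    not_pertSlice_uncentred_lin zero_le_one (by norm_num) one_pos (by norm_num) (mem_closedBall_self zero_le_one)
      (by norm_num)⟩

end

end Summit.QuantumFields.BalabanUV.T4Continuum.T4TrajectoryDensityDressed
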